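import Mathlib

/-! # T4 · MIMICRY LEMMA — statement sketch (crux-strategist s1, census STRATEGY-CENSUS-s1.md §Transfer T4)

An algebraic integer `x` of degree `≤ d` all of whose conjugates have absolute value `≤ B` (`B ≥ 1`),
which is killed by a ring map from a subring of `ℂ` containing it onto `ℤ/pⁿ`, is either `0` or
satisfies `pⁿ ≤ B^d`. Applied to `x = a_ℓ(g) − a_ℓ(E)` (`B = 4√ℓ`): a degree-`≤ d` depth-`n` shadow
mimics `E` exactly at every unramified prime `ℓ` with `16ℓ < p^{2n/d}`. Statement only (elaborates);
the proof is `pⁿ ∣ m(0)` for the minimal polynomial `m` of `x` plus `|m(0)| ≤ B^{deg m}`. -/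

namespace Summit.BirchSwinnertonDyer.BirchSwinnertonDyer.Cruxes.IsolationOfAccidentalZeros.Mimicry

/-- The mimicry / Liouville-repulsion statement (T4). -/
def Mimicry : Prop :=
  ∀ (p n d : ℕ) (B : ℝ), p.Prime → 1 ≤ B → ∀ (x : ℂ), IsIntegral ℤ x →
    (minpoly ℚ x).natDegree ≤ d →
    (∀ y : ℂ, Polynomial.aeval y (minpoly ℚ x) = 0 → ‖y‖ ≤ B) →
    (∃ (R : Subring ℂ) (φ : R →+* ZMod (p ^ n)) (hx : x ∈ R), φ ⟨x, hx⟩ = 0) →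
    x = 0 ∨ (p : ℝ) ^ n ≤ B ^ d

/-- The key divisibility behind it, as its own statement: the constant coefficient of the `ℤ`-minimal
polynomial is divisible by `pⁿ`. -/
def ConstCoeffDivisible : Prop :=
  ∀ (p n : ℕ) (x : ℂ), IsIntegral ℤ x →
    (∃ (R : Subring ℂ) (φ : R →+* ZMod (p ^ n)) (hx : x ∈ R), φ ⟨x, hx⟩ = 0) →
    ((p : ℤ) ^ n ∣ (minpoly ℤ x).coeff 0)

example : Mimicry → True := fun _ => trivial

end Summit.BirchSwinnertonDyer.BirchSwinnertonDyer.Cruxes.IsolationOfAccidentalZeros.Mimicry
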